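import Mathlib
import HarnessLib
import Summits.Ventures.LatticeQCDFlow.Exactness.NCMCGeneralSpaceAsymptoticVarianceLowerBound

/-!
# Under ANY Doeblin power every non-trivial event has a positive integrated autocorrelation time: `0 < τ_int(setACF κ π A)` for `(nHit κ m)(x, ·) ≥ ε ν` — the positivity hypothesis of the exact-coverage theorems, discharged for the cell's certificate shape (the NCMC lane's two-step certificate included)

HONEST FRAMING: exact (Metropolis-corrected) sampling algorithms for lattice gauge theory;
figures of merit are autocorrelation/cost numbers at stated couplings and volumes; no
continuum-physics claim.

Venture `LatticeQCDFlow` (cell pub-lqcd), topic `Exactness`; FANOUT row 13 (`eng-snf`, GEN-21).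
NEW WORK of the cell, not a published result; no definition is introduced; nothing is cited as a
fact.  GEN-20's studentized-CLT / exact-coverage theorems for events
(`NCMCGeneralSpaceOccupancyChainGammaCoverage`, `…GammaMethodIntervalForm`,
`…TauIntWindowConsistency`) ASSUME `0 < τ_int(setACF κ π A)`; GEN-20's
`NCMCGeneralSpaceAsymptoticVarianceLowerBound` derived it, with a constant, for a ONE-step
minorisation only, and left the `m`-step case (the NCMC lane's two-step certificate) open.  For a
general bounded observable the `m`-step statement is FALSE (a three-state kernel with a Doeblin
square carries a three-valued observable whose partial sums telescope — companion file
`NCMCGeneralSpaceAsymptoticVarianceCounterexample`); for the INDICATOR OF AN EVENT it is TRUE, by a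
phase-rigidity argument that uses only the two-valuedness of the observable:

if `σ² = π(h²) − π((κh)²) = 0` for the bounded Poisson solution `h − κh = 1_A − p` (`p = π(A)`), then
`h(X₁) = κh(X₀) = h(X₀) − 1_A(X₀) + p` almost surely, so the PHASE `φ = fract ∘ h` obeys
`φ(X₁) = fract(φ(X₀) + p)` a.s., hence `φ(X_t) = fract(φ(X₀) + t p)` a.s. for every `t` (invariance
transports almost-sure statements along the chain); the minorisation `κ^m(x, ·) ≥ ε ν` then forces
`fract(φ(x) + m p)` to be the SAME constant for `π`-a.e. `x` (it is the `ν`-a.s. value of `φ`), so `φ`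
is `π`-a.s. a constant `φ₀`, and one more step gives `fract(φ₀ + p) = φ₀`, i.e. `p ∈ ℤ` — impossible
for `0 < p < 1`.  Since `σ² = 2 τ_int(ρ_A) p(1 − p)` (GEN-19) and `σ² ≥ 0` (conditional variances),
`τ_int(ρ_A) > 0`.  No constant is claimed (none exists at this generality: the bound must depend on
more than `ε`, `m`, `p`).

## Content (`κ` Markov, `π` invariant probability law, `ε • ν ≤ (nHit κ m)(x, ·)` for all `x`, `ν` a
## probability law, `ε ≠ 0`, `0 < m`)

* `fract_fract_add` — `fract(fract a + b) = fract(a + b)`.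
* `ae_ae_kernel_of_invariant` — invariance transports `π`-a.s. statements: `(∀ᵐ y ∂π, P y) →
  ∀ᵐ x ∂π, ∀ᵐ y ∂κ(x, ·), P y`.
* `integral_condVar_eq_sq_sub_sq_kop` — `∫ (κ(h²) − (κh)²) dπ = ∫ h² dπ − ∫ (κh)² dπ`.
* `ae_kernel_eq_kop_of_condVar_zero` — if `∫ h² dπ − ∫ (κh)² dπ = 0` then for `π`-a.e. `x`,
  `h = κh(x)` holds `κ(x, ·)`-a.s.
* **`tauInt_setACF_pos_of_nHit`** — for every measurable `A` with `0 < π(A) < 1`: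
  `0 < Scoring.tauInt (setACF κ π A)`.
* **`greenKubo_variance_indicator_pos_of_nHit`** — the same in the Green–Kubo form used by the
  studentized CLT files: `0 < C_f̄(0) + 2 Σ' C_f̄(t+1)` for `f = 1_A`.

NOT CLAIMED: any lower bound for `τ_int` in terms of `ε, m, π(A)` (false in general); general bounded
(more than two-valued) observables (false, see the counterexample file); unbounded observables.
-/

namespace Summit.Ventures.LatticeQCDFlow.Exactness.GeneralNCMC

open MeasureTheory ProbabilityTheory Set Filter Finset
open scoped ENNReal NNReal Topology

variable {S : Type*} [MeasurableSpace S]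

/-! ## §1 Lemmas -/

section Lemmas

/-- `fract (fract a + b) = fract (a + b)`. -/
theorem fract_fract_add (a b : ℝ) : Int.fract (Int.fract a + b) = Int.fract (a + b) := by
  rw [← Int.self_sub_floor a, show a - (⌊a⌋ : ℝ) + b = a + b - (⌊a⌋ : ℝ) by ring,
    Int.fract_sub_intCast]

variable {κ : Kernel S S} {π : Measure S}

/-- **Invariance transports almost-sure statements along the chain**: if `P` holds `π`-a.s. and `π`
is `κ`-invariant, then for `π`-a.e. `x` it holds `κ(x, ·)`-a.s. -/
theorem ae_ae_kernel_of_invariant (hπ : Kernel.Invariant κ π) {P : S → Prop}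
    (h : ∀ᵐ y ∂π, P y) : ∀ᵐ x ∂π, ∀ᵐ y ∂(κ x), P y := by
  have h' : ∀ᵐ y ∂(κ ∘ₘ π), P y := by
    have hdef : κ ∘ₘ π = π := hπ.def
    rw [hdef]; exact h
  exact Measure.ae_ae_of_ae_comp h'

/-- An almost-sure statement for `c • μ` (`c ≠ 0`) is an almost-sure statement for `μ`. -/
theorem ae_of_ae_smul_measure {μ : Measure S} {c : ℝ≥0∞} (hc : c ≠ 0)
    {P : S → Prop} (h : ∀ᵐ x ∂(c • μ), P x) : ∀ᵐ x ∂μ, P x := by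
  rw [ae_iff] at h ⊢
  rw [Measure.smul_apply, smul_eq_mul, mul_eq_zero] at h
  exact h.resolve_left hc

variable [IsMarkovKernel κ] [IsProbabilityMeasure π]

/-- `∫ (κ(h²) − (κh)²) dπ = ∫ h² dπ − ∫ (κh)² dπ` for `π` invariant and `h` bounded measurable. -/
theorem integral_condVar_eq_sq_sub_sq_kop (hπ : Kernel.Invariant κ π) {h : S → ℝ}
    (hhm : Measurable h) {Ch : ℝ} (hhb : ∀ x, |h x| ≤ Ch) :
    ∫ x, (Scoring.kop κ (fun y => h y ^ 2) x - (Scoring.kop κ h x) ^ 2) ∂π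
      = ∫ x, h x ^ 2 ∂π - ∫ x, (Scoring.kop κ h x) ^ 2 ∂π := by
  obtain ⟨hKm, hKb⟩ := Scoring.iterate_kop_bounded_measurable κ hhm hhb 1
  simp only [Function.iterate_one] at hKm hKb
  have hh2m : Measurable fun y => h y ^ 2 := hhm.pow_const 2
  have hh2b : ∀ y, |h y ^ 2| ≤ Ch ^ 2 := fun y => by
    rw [abs_pow]; exact pow_le_pow_left₀ (abs_nonneg _) (hhb y) 2
  rw [integral_sub (Scoring.integrable_of_bounded π (Scoring.measurable_kop κ hh2m)
      (Scoring.abs_kop_le κ hh2b))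
    (Scoring.integrable_of_bounded π (hKm.pow_const 2) (C := Ch ^ 2) fun y => by
      rw [abs_pow]; exact pow_le_pow_left₀ (abs_nonneg _) (hKb y) 2),
    Scoring.integral_kop κ hπ hh2m hh2b]

/-- The conditional-variance observable `κ(h²) − (κh)²` is non-negative. -/
theorem condVar_nonneg {h : S → ℝ} (hhm : Measurable h) {Ch : ℝ} (hhb : ∀ x, |h x| ≤ Ch) (x : S) :
    0 ≤ Scoring.kop κ (fun y => h y ^ 2) x - (Scoring.kop κ h x) ^ 2 := by
  rw [kop_sq_sub_sq_eq_integral κ hhm hhb x]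
  exact integral_nonneg fun _ => sq_nonneg _

/-- `0 ≤ ∫ h² dπ − ∫ (κh)² dπ` (`π` invariant). -/
theorem sq_sub_sq_kop_nonneg (hπ : Kernel.Invariant κ π) {h : S → ℝ} (hhm : Measurable h)
    {Ch : ℝ} (hhb : ∀ x, |h x| ≤ Ch) :
    0 ≤ ∫ x, h x ^ 2 ∂π - ∫ x, (Scoring.kop κ h x) ^ 2 ∂π := by
  rw [← integral_condVar_eq_sq_sub_sq_kop hπ hhm hhb]
  exact integral_nonneg fun x => condVar_nonneg hhm hhb x

/-- **A vanishing martingale variance freezes the chain onto the Poisson solution**: if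
`∫ h² dπ − ∫ (κh)² dπ = 0` then for `π`-a.e. `x`, `κ(x, ·)`-a.e. `y`: `h y = κh(x)`. -/
theorem ae_kernel_eq_kop_of_condVar_zero (hπ : Kernel.Invariant κ π) {h : S → ℝ}
    (hhm : Measurable h) {Ch : ℝ} (hhb : ∀ x, |h x| ≤ Ch)
    (hzero : ∫ x, h x ^ 2 ∂π - ∫ x, (Scoring.kop κ h x) ^ 2 ∂π = 0) :
    ∀ᵐ x ∂π, ∀ᵐ y ∂(κ x), h y = Scoring.kop κ h x := by
  obtain ⟨hKm, hKb⟩ := Scoring.iterate_kop_bounded_measurable κ hhm hhb 1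
  simp only [Function.iterate_one] at hKm hKb
  -- the conditional variance is bounded measurable, non-negative, with integral zero
  have hqm : Measurable fun x => Scoring.kop κ (fun y => h y ^ 2) x - (Scoring.kop κ h x) ^ 2 :=
    (Scoring.measurable_kop κ (hhm.pow_const 2)).sub (hKm.pow_const 2)
  have hqb : ∀ x, |Scoring.kop κ (fun y => h y ^ 2) x - (Scoring.kop κ h x) ^ 2| ≤ Ch ^ 2 + Ch ^ 2 :=
    fun x => (abs_sub _ _).trans (add_le_add
      (Scoring.abs_kop_le κ (fun y => by
        rw [abs_pow]; exact pow_le_pow_left₀ (abs_nonneg _) (hhb y) 2) x)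
      (by rw [abs_pow]; exact pow_le_pow_left₀ (abs_nonneg _) (hKb x) 2))
  have hiq : Integrable (fun x => Scoring.kop κ (fun y => h y ^ 2) x - (Scoring.kop κ h x) ^ 2) π :=
    Scoring.integrable_of_bounded π hqm hqb
  have hq0 : ∫ x, (Scoring.kop κ (fun y => h y ^ 2) x - (Scoring.kop κ h x) ^ 2) ∂π = 0 := by
    rw [integral_condVar_eq_sq_sub_sq_kop hπ hhm hhb]; exact hzero
  have hqae := (integral_eq_zero_iff_of_nonneg (fun x => condVar_nonneg hhm hhb x) hiq).1 hq0
  filter_upwards [hqae] with x hx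
  have hx' : ∫ y, (h y - Scoring.kop κ h x) ^ 2 ∂(κ x) = 0 := by
    rw [← kop_sq_sub_sq_eq_integral κ hhm hhb x]; exact hx
  have hi : Integrable (fun y => (h y - Scoring.kop κ h x) ^ 2) (κ x) :=
    Scoring.integrable_of_bounded _ ((hhm.sub measurable_const).pow_const 2) (C := (Ch + Ch) ^ 2)
      fun y => by
        rw [abs_pow]
        exact pow_le_pow_left₀ (abs_nonneg _) ((abs_sub _ _).trans (add_le_add (hhb y) (hKb x))) 2
  have hae := (integral_eq_zero_iff_of_nonneg (fun y => sq_nonneg _) hi).1 hx'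
  filter_upwards [hae] with y hy
  have hy' : (h y - Scoring.kop κ h x) ^ 2 = 0 := hy
  exact sub_eq_zero.1 ((pow_eq_zero_iff two_ne_zero).1 hy')

end Lemmas

/-! ## §2 Positivity of `τ_int` for every event under a Doeblin power -/

section Positivity

variable {κ : Kernel S S} [IsMarkovKernel κ] {π : Measure S} [IsProbabilityMeasure π]
  {ν : Measure S} [IsProbabilityMeasure ν] {ε : ℝ≥0∞} {m : ℕ}

/-- **EVERY NON-TRIVIAL EVENT HAS A POSITIVE INTEGRATED AUTOCORRELATION TIME UNDER A DOEBLIN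
POWER.**  `κ` Markov with invariant probability law `π`, `ε • ν ≤ (nHit κ m)(x, ·)` for all `x`
(`ε ≠ 0`, `0 < m`, `ν` a probability law), `A` measurable with `0 < π(A) < 1`.  Then
`0 < Scoring.tauInt (setACF κ π A)`. -/
theorem tauInt_setACF_pos_of_nHit (hπ : Kernel.Invariant κ π) (hε : ε ≠ 0)
    (hmin : ∀ z, ε • ν ≤ nHit κ m z) (hm : 0 < m) {A : Set S} (hA : MeasurableSet A)
    (h0 : 0 < π.real A) (h1 : π.real A < 1) :
    0 < Scoring.tauInt (setACF κ π A) := by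
  haveI : Nonempty S := nonempty_of_isProbabilityMeasure π
  have hε1 : ε ≤ 1 := by
    haveI := isMarkovKernel_nHit κ m
    exact eps_le_one_of_minorised hmin
  have hε0 : 0 < ε := pos_iff_ne_zero.2 hε
  have hminS : ∀ x {B : Set S}, MeasurableSet B → ε * ν B ≤ nHit κ m x B :=
    fun z B hB => minorised_setwise hmin z hB
  set p : ℝ := π.real A with hp
  have hv0 : 0 < p * (1 - p) := mul_pos h0 (sub_pos.2 h1)
  -- the indicator observable
  have hf : Measurable (A.indicator (1 : S → ℝ)) := measurable_one.indicator hA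
  have hC : ∀ y, |A.indicator (1 : S → ℝ) y| ≤ 1 := fun y => by
    by_cases hy : y ∈ A <;> simp [hy]
  have hmean : ∫ z, A.indicator (1 : S → ℝ) z ∂π = p := integral_indicator_one hA
  obtain ⟨hfb, hCfb, hfb0⟩ := Scoring.centred_observable_bounds π hf hC
  -- Poisson solution and the martingale form of `σ²`
  obtain ⟨h, hhm, hhb, hpois⟩ := poisson_exists_of_nHit hminS hε0 hε1 hm hπ hfb hCfb hfb0
  have hGK := integral_sq_sub_sq_kop_eq_greenKubo_of_nHit hminS hε0 hε1 hm hπ hfb hCfb hfb0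
    hhm hhb hpois
  -- `σ² = 2 τ p (1 − p)`
  have hσ : ∫ x, h x ^ 2 ∂π - ∫ x, (Scoring.kop κ h x) ^ 2 ∂π
      = 2 * Scoring.tauInt (setACF κ π A) * (p * (1 - p)) := by
    rw [hGK, hp, ← greenKubo_indicator_eq_tauInt hπ hA h0 h1]
    unfold Scoring.autocov
    rfl
  -- it suffices that `σ² ≠ 0`
  suffices hne : ∫ x, h x ^ 2 ∂π - ∫ x, (Scoring.kop κ h x) ^ 2 ∂π ≠ 0 by
    have hpos : 0 < 2 * Scoring.tauInt (setACF κ π A) * (p * (1 - p)) := by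
      rw [← hσ]; exact lt_of_le_of_ne (sq_sub_sq_kop_nonneg hπ hhm hhb) (Ne.symm hne)
    exact pos_of_mul_pos_right ((mul_pos_iff_of_pos_right hv0).1 hpos) (by norm_num)
  intro hzero
  -- (1) the chain is frozen onto the Poisson solution: `h(X₁) = h(X₀) − 1_A(X₀) + p` a.s.
  have hstep : ∀ᵐ x ∂π, ∀ᵐ y ∂(κ x), h y = h x - (A.indicator (1 : S → ℝ) x - p) := by
    filter_upwards [ae_kernel_eq_kop_of_condVar_zero hπ hhm hhb hzero] with x hx
    filter_upwards [hx] with y hy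
    have hpx := hpois x
    rw [hmean] at hpx
    rw [hy]; linarith
  -- (2) the phase `φ = fract ∘ h`
  obtain ⟨φ, hφ⟩ : ∃ φ : S → ℝ, ∀ x, φ x = Int.fract (h x) := ⟨fun x => Int.fract (h x), fun _ => rfl⟩
  have hφm : Measurable φ := by
    have : φ = fun x => Int.fract (h x) := funext hφ
    rw [this]; exact hhm.fract
  have hφS : ∀ c : ℝ, MeasurableSet {y | φ y = c} := fun c => hφm (measurableSet_singleton c)
  have hφ01 : ∀ x, Int.fract (φ x) = φ x := fun x => by rw [hφ x, Int.fract_fract]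
  -- one step: `φ(X₁) = fract(φ(X₀) + p)` a.s.
  have hC1 : ∀ᵐ x ∂π, ∀ᵐ y ∂(κ x), φ y = Int.fract (φ x + p) := by
    filter_upwards [hstep] with x hx
    filter_upwards [hx] with y hy
    rw [hφ y, hφ x, fract_fract_add, hy]
    by_cases hxA : x ∈ A
    · rw [indicator_of_mem hxA, Pi.one_apply,
        show h x - (1 - p) = h x + p - 1 by ring, Int.fract_sub_one]
    · rw [indicator_of_notMem hxA, zero_sub, sub_neg_eq_add]
  -- `t` steps: `φ(X_t) = fract(φ(X₀) + t p)` a.s.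
  have hC2 : ∀ t : ℕ, ∀ᵐ x ∂π, ∀ᵐ y ∂(nHit κ t x), φ y = Int.fract (φ x + t * p) := by
    intro t
    induction t with
    | zero =>
      refine ae_of_all _ fun x => ?_
      rw [nHit_zero, Kernel.id_apply, Nat.cast_zero, zero_mul, add_zero, hφ01 x]
      exact (ae_dirac_iff (hφS (φ x))).2 rfl
    | succ t ih =>
      have hG := ae_ae_kernel_of_invariant (invariant_nHit hπ t) hC1
      filter_upwards [ih, hG] with x hx hGx
      rw [nHit_succ]
      refine Kernel.ae_comp_of_ae_ae (hφS _) ?_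
      filter_upwards [hx, hGx] with z hz hGz
      filter_upwards [hGz] with y hy
      rw [hy, hz, fract_fract_add, Nat.cast_succ, add_assoc, ← add_one_mul]
  -- (3) the minorisation: `ν`-a.s. `φ = fract(φ(x) + m p)` for `π`-a.e. `x`
  have hC3 : ∀ᵐ x ∂π, ∀ᵐ y ∂ν, φ y = Int.fract (φ x + m * p) := by
    filter_upwards [hC2 m] with x hx
    exact ae_of_ae_smul_measure hε (hx.filter_mono (ae_mono (hmin x)))
  obtain ⟨x₀, hx₀⟩ := hC3.exists
  have hC3' : ∀ᵐ x ∂π, Int.fract (φ x + m * p) = Int.fract (φ x₀ + m * p) := by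
    filter_upwards [hC3] with x hx
    obtain ⟨y, hy1, hy2⟩ := (hx.and hx₀).exists
    rw [← hy1, hy2]
  -- hence `φ` is `π`-a.s. the constant `φ₀`
  set φ₀ : ℝ := Int.fract (Int.fract (φ x₀ + m * p) - m * p) with hφ₀
  have hC3'' : ∀ᵐ x ∂π, φ x = φ₀ := by
    filter_upwards [hC3'] with x hx
    have hx' : φ x = Int.fract (φ x₀ + m * p) - m * p + ((⌊φ x + m * p⌋ : ℤ) : ℝ) := by
      rw [← hx, ← Int.self_sub_floor]; ring
    rw [← hφ01 x, hx', Int.fract_add_intCast]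
  -- (4) one more step: `fract(φ₀ + p) = φ₀`
  have hfin : ∀ᵐ x ∂π, ∀ᵐ y ∂(κ x), φ₀ = Int.fract (φ₀ + p) := by
    filter_upwards [hC1, ae_ae_kernel_of_invariant hπ hC3'', hC3''] with x h1x h4x h3x
    filter_upwards [h1x, h4x] with y hy1 hy4
    calc φ₀ = φ y := hy4.symm
      _ = Int.fract (φ x + p) := hy1
      _ = Int.fract (φ₀ + p) := by rw [h3x]
  obtain ⟨x₁, hx₁⟩ := hfin.exists
  obtain ⟨y₁, hy₁⟩ := hx₁.exists
  -- so `p` is an integer strictly between `0` and `1`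
  have hkey : p = ((⌊φ₀ + p⌋ : ℤ) : ℝ) := by
    have := Int.self_sub_floor (φ₀ + p)
    linarith
  have i0 : (0 : ℤ) < ⌊φ₀ + p⌋ := by
    have h0' : (0 : ℝ) < ((⌊φ₀ + p⌋ : ℤ) : ℝ) := by rw [← hkey]; exact h0
    exact_mod_cast h0'
  have i1 : ⌊φ₀ + p⌋ < (1 : ℤ) := by
    have h1' : ((⌊φ₀ + p⌋ : ℤ) : ℝ) < 1 := by rw [← hkey]; exact h1
    exact_mod_cast h1'
  omega

/-- **The Green–Kubo variance of a centred indicator is positive under a Doeblin power** (the form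
`0 < C_f̄(0) + 2 Σ' C_f̄(t+1)` consumed by the studentized-CLT files), for every measurable `A` with
`0 < π(A) < 1`. -/
theorem greenKubo_variance_indicator_pos_of_nHit (hπ : Kernel.Invariant κ π) (hε : ε ≠ 0)
    (hmin : ∀ z, ε • ν ≤ nHit κ m z) (hm : 0 < m) {A : Set S} (hA : MeasurableSet A)
    (h0 : 0 < π.real A) (h1 : π.real A < 1) :
    0 < Scoring.autocov κ π (fun y => A.indicator (1 : S → ℝ) y - ∫ z, A.indicator 1 z ∂π) 0
      + 2 * ∑' t, Scoring.autocov κ π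
        (fun y => A.indicator (1 : S → ℝ) y - ∫ z, A.indicator 1 z ∂π) (t + 1) := by
  rw [← cltVariance_eq_autocov κ π, greenKubo_indicator_eq_tauInt hπ hA h0 h1]
  have hτ := tauInt_setACF_pos_of_nHit hπ hε hmin hm hA h0 h1
  have hv0 : 0 < π.real A * (1 - π.real A) := mul_pos h0 (sub_pos.2 h1)
  positivity

end Positivity

end Summit.Ventures.LatticeQCDFlow.Exactness.GeneralNCMC
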